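import Summits.QuantumFields.BalabanUV.Beta.CompositeAveragingCoarseExactGeneric
import Summits.QuantumFields.BalabanUV.Beta.CompositeCorrectorForms

/-!
# `BalabanUV.Beta.CompositeAveragingCoarseExactGenericGauge` — binder row D1 ∕ (C1): THE PURE-GAUGE INPUTS OF THE SCHEME-GENERIC COMPOSITE AVERAGING —
# «exact in ⟹ exact out» and **NILPOTENCY OF THE COMPOSITE DEFECT POTENTIAL ON BLOCK-CONSTANT PURE GAUGES** (`CompositeCorrectorForms` §3's `compLinAvgAt_dz_ext` ∕
# `compDefectAt_dz_ext`, an2 g24) re-proved for ANY one-step family (§1) from two one-step letters, and DISCHARGED for the (0.4)-SYMMETRISED scheme (§2–§3):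
# **`compLinAvgSymAt_dz_ext`**, **`compDefectSymAt_dz_ext`** — K-U3d-sym's SECOND form-level brick (row OWNER an2 gen 89; sequel of PART 124 `CompositeAveragingCoarseExactGeneric`)

WHAT ([folklore] finite-difference algebra; no `def`, nothing cited, no `Prop` fact):
* §1 GENERIC.  For a one-step family `Av`, potentials `lam`, block side `L > 0` and a scalar `c` (the one-step mass of a block-constant exact form), from the two one-step letters
  (E) `∀ k j g, Av k (dz (ext (L^(j+1)) g)) = dz (ext (L^j) (c • g))` and (Z) `∀ k j g, lam k (dz (ext (L^(j+1)) g)) = 0`: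
  **`compAvOf_dz_ext`** `compAvOf Av k (dz (ext (L^(j+k)) g)) = dz (ext (L^j) (c^k • g))` and **`compDefectOf_dz_ext`** `compDefectOf Av lam L m (dz (ext (L^(j+m)) g)) = 0` (+ `_self` at `j = 0`).
* §2 THE (0.4) ONE-STEP LETTERS (in-block roots `ρs k = toSite (r k)`, `r k ∈ box d L`): **`SymLamAt_dz_ext_succ`** ∕ **`zetaS_dz_ext_succ`** (the symmetrised block potential of an
  exact form constant on the level's blocks VANISHES — `symAxial_grad`, `blk_pow_succ`) = letter (Z); **`SymLamAt_dz`** (`SymLamAt ρ (dz F) L = d! • (blockSum L F − |box L| • F(L•·+ρ))`),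
  **`symLinAvgAt_dz`** (`symLinAvgAt ρ (dz F) L = (d!·|box L|) • dz (F (L•·+ρ))` — the (0.4) twin of an1's `linAvgAt_grad`), **`avSym_dz_ext_succ`** = letter (E) with `c = |box L|`.
* §3 THE (0.4) INSTANCE: **`compLinAvgSymAt_dz_ext`**, **`compDefectSymAt_dz_ext`**, **`compDefectSymAt_dz_ext_self`** — the m-fold composite (0.4) average maps the straight block-constant
  gauge direction to the coarser one with mass `|box L|^k`, and its defect potential KILLS block-constant pure gauges: exactly the input that makes the corrector pair
  `Φˢ_m A := A − |box (L^m)|⁻¹ • dz (ext (L^m) (ζˢ_m A))`, `Ψˢ_m A := A + …` MUTUALLY INVERSE (`CompositeCorrectorForms.corrPsi_corrPhi`'s pattern; NOT typed here).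
WHY: road XREAD-L v1.3's displayed corrector letters `hΨΦ hΦΨ` (and K-U3d's `relInv_congr`) need the nilpotency; PART 124 gave coarse-exactness; this gives nilpotency; the pair and its
kernelisation are the sequels.  HONEST: lattice algebra BY NAME; nothing of Bałaban's asserted, valued or discharged; L NOT commissioned; no END row discharged; the literal of record,
ROOT M‴ ∕ P5c ∕ D6, v10 + END v3 + W untouched; 0∕4 row-D1 binders; NOT (C1), NOT (T-ID), NOT D1, NEVER «G-an2-4 closed», NOT BetaPertH, NOT continuum, NOT Clay.
HONEST DEPENDENCY (page 1, mandatory): continuum YM on T⁴ ⇐ BetaPertH ∧ nine spine estimates (0/9 proved); BetaPertH ⇐ (D1) ∧ (D4) ∧ CAP+tail; G-an2-4 gates asym, D1 and NE2/3/4.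
Row D1 ∕ (C1) OWNER an2, gen 89, 2026-08-30; over PART 124, an2 g24 `CompositeCorrectorForms`, an2 `SymCorrectorForms`∕`SymmetrisedAxialPotential` BY NAME; no existing file touched.
-/

namespace Summit.QuantumFields.BalabanUV.Beta.CompositeAveragingCoarseExactGeneric

open Finset
open scoped BigOperators Nat
open Literature.MathematicalPhysics.QuantumFieldTheory.Balaban1983to89.Beta
open AffineAveraging (Site Form0 Form1 box toSite unitVec dz blockSum contourSum contourSum_dz)
open AveragingContours (blk blk_block grad grad_eq_dz)
open Summit.QuantumFields.BalabanUV.Beta.SymmetrisedAxialPotential (symAxial SymLamAt symLinAvgAt symAxial_grad symLinAvgAt_eq_contourSum_sub_dz)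
open Summit.QuantumFields.BalabanUV.Beta.SymCorrectorForms (zetaS zetaS_apply)
open Summit.QuantumFields.BalabanUV.Beta.CompositeCorrectorForms (ext ext_apply blk_blk blk_pow_succ ext_succ_apply blockSum_zero)

noncomputable section

variable {d : ℕ}

/-! ## §1 Generic: exact block-constant inputs and the nilpotency of the composite potential -/

section Generic

variable (Av : ℕ → Form1 d ℝ → Form1 d ℝ) (lam : ℕ → Form1 d ℝ → Form0 d ℝ) (L : ℕ) (c : ℝ)

/-- [folklore] **EXACT BLOCK-CONSTANT IN ⟹ COARSER EXACT BLOCK-CONSTANT OUT, GENERIC**: from the one-step letter (E) `Av k (dz (ext (L^(j+1)) g)) = dz (ext (L^j) (c • g))`,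
the k-fold composite maps `dz (ext (L^(j+k)) g)` to `dz (ext (L^j) (c^k • g))`. -/
theorem compAvOf_dz_ext (hE : ∀ (k j : ℕ) (g : Form0 d ℝ), Av k (dz (ext (L ^ (j + 1)) g)) = dz (ext (L ^ j) (c • g))) (g : Form0 d ℝ) :
    ∀ k j : ℕ, compAvOf Av k (dz (ext (L ^ (j + k)) g)) = dz (ext (L ^ j) ((c ^ k) • g))
  | 0, j => by simp [compAvOf]
  | k + 1, j => by
      rw [compAvOf_succ, show j + (k + 1) = (j + 1) + k by ring, compAvOf_dz_ext hE g k (j + 1), hE k j, smul_smul, ← pow_succ']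

/-- [folklore] **NILPOTENCY OF THE COMPOSITE DEFECT POTENTIAL, GENERIC**: from (E) and the one-step letter (Z) `lam k (dz (ext (L^(j+1)) g)) = 0`,
`compDefectOf Av lam L m (dz (ext (L^(j+m)) g)) = 0` for all `m`, `j`. -/
theorem compDefectOf_dz_ext (hE : ∀ (k j : ℕ) (g : Form0 d ℝ), Av k (dz (ext (L ^ (j + 1)) g)) = dz (ext (L ^ j) (c • g)))
    (hZ : ∀ (k j : ℕ) (g : Form0 d ℝ), lam k (dz (ext (L ^ (j + 1)) g)) = 0) (g : Form0 d ℝ) :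
    ∀ m j : ℕ, compDefectOf Av lam L m (dz (ext (L ^ (j + m)) g)) = 0
  | 0, j => rfl
  | m + 1, j => by
      rw [compDefectOf_succ, show j + (m + 1) = (j + 1) + m by ring, compDefectOf_dz_ext hE hZ g m (j + 1),
        compAvOf_dz_ext Av L c hE g m (j + 1), hZ m j, add_zero, blockSum_zero]

/-- [folklore] The case `j = 0`: the potential kills `dz (ext (L^m) g)`. -/
theorem compDefectOf_dz_ext_self (hE : ∀ (k j : ℕ) (g : Form0 d ℝ), Av k (dz (ext (L ^ (j + 1)) g)) = dz (ext (L ^ j) (c • g)))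
    (hZ : ∀ (k j : ℕ) (g : Form0 d ℝ), lam k (dz (ext (L ^ (j + 1)) g)) = 0) (g : Form0 d ℝ) (m : ℕ) :
    compDefectOf Av lam L m (dz (ext (L ^ m) g)) = 0 := by
  have h := compDefectOf_dz_ext Av lam L c hE hZ g m 0
  rwa [zero_add] at h

end Generic

/-! ## §2 The (0.4) one-step letters: the symmetrised potential kills block-constant gauges; the (0.4) average of an exact form -/

section SymLetters

/-- [folklore] **THE SYMMETRISED BLOCK POTENTIAL OF AN EXACT FORM CONSTANT ON THE LEVEL's BLOCKS VANISHES** (in-block root; twin of `CompositeCorrectorForms.treeGaugeAt_dz_ext_succ`):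
every symmetrised contour from the block root to a block site integrates `dz (ext (L^(j+1)) g)` to `g (blk …) − g (blk …) = 0` (`symAxial_grad`, `blk_pow_succ`). -/
theorem SymLamAt_dz_ext_succ {L : ℕ} (hL : 0 < L) {r : Fin d → ℕ} (hr : r ∈ box d L) (j : ℕ) (g : Form0 d ℝ) :
    SymLamAt (toSite r) (dz (ext (L ^ (j + 1)) g)) L = 0 := by
  funext Y
  rw [SymLamAt, Pi.zero_apply]
  refine Finset.sum_eq_zero fun b hb => ?_
  rw [← grad_eq_dz, symAxial_grad, ext_apply, ext_apply, blk_pow_succ hL hb, blk_pow_succ hL hr, sub_self, mul_zero]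

/-- [folklore] Letter (Z) for the (0.4) scheme: `ζ_S (dz (ext (L^(j+1)) g)) = 0`. -/
theorem zetaS_dz_ext_succ {L : ℕ} (hL : 0 < L) {r : Fin d → ℕ} (hr : r ∈ box d L) (j : ℕ) (g : Form0 d ℝ) :
    zetaS (toSite r) L (dz (ext (L ^ (j + 1)) g)) = 0 := by
  funext Y
  rw [zetaS_apply, SymLamAt_dz_ext_succ hL hr, Pi.zero_apply, mul_zero]

/-- [folklore] **THE SYMMETRISED BLOCK POTENTIAL OF AN EXACT FORM**: `SymLamAt ρ (dz F) L Y = d! · (blockSum L F Y − |box L| · F (L•Y + ρ))` (`symAxial_grad` summed over the block). -/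
theorem SymLamAt_dz (ρ : Site d) (F : Form0 d ℝ) (L : ℕ) (Y : Site d) :
    SymLamAt ρ (dz F) L Y = (d ! : ℝ) * (blockSum L F Y - ((box d L).card : ℝ) * F ((L : ℤ) • Y + ρ)) := by
  rw [SymLamAt, ← grad_eq_dz]
  simp only [symAxial_grad]
  rw [← Finset.mul_sum, Finset.sum_sub_distrib, Finset.sum_const, nsmul_eq_mul]
  rfl

/-- [folklore] **THE (0.4) AVERAGE OF AN EXACT FORM** (twin of an1's `AveragingContoursRooted.linAvgAt_grad`, read as a coarse exterior derivative):
`symLinAvgAt ρ (dz F) L μ y = d! · |box L| · (F (L•y + ρ + L•e_μ) − F (L•y + ρ))`. -/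
theorem symLinAvgAt_dz (ρ : Site d) (F : Form0 d ℝ) (L : ℕ) (μ : Fin d) (y : Site d) :
    symLinAvgAt ρ (dz F) L μ y = (d ! : ℝ) * (((box d L).card : ℝ) * (F ((L : ℤ) • y + ρ + (L : ℤ) • unitVec μ) - F ((L : ℤ) • y + ρ))) := by
  rw [symLinAvgAt_eq_contourSum_sub_dz, contourSum_dz]
  have h1 : dz (SymLamAt ρ (dz F) L) μ y = SymLamAt ρ (dz F) L (y + unitVec μ) - SymLamAt ρ (dz F) L y := rfl
  have h2 : dz (blockSum L F) μ y = blockSum L F (y + unitVec μ) - blockSum L F y := rfl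
  rw [h1, h2, SymLamAt_dz, SymLamAt_dz, smul_add]
  ring

/-- [folklore] Letter (E) for the (0.4) scheme (in-block root): `avSym k (dz (ext (L^(j+1)) g)) = dz (ext (L^j) (|box L| • g))`. -/
theorem avSym_dz_ext_succ {L : ℕ} (hL : 0 < L) (r : ℕ → (Fin d → ℕ)) (hr : ∀ k, r k ∈ box d L) (k j : ℕ) (g : Form0 d ℝ) :
    avSym (fun k => toSite (r k)) L k (dz (ext (L ^ (j + 1)) g)) = dz (ext (L ^ j) ((((box d L).card : ℝ)) • g)) := by
  have hd : ((d ! : ℕ) : ℝ) ≠ 0 := by exact_mod_cast (Nat.factorial_pos d).ne'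
  funext μ y
  rw [avSym_apply, symLinAvgAt_dz, ← mul_assoc, inv_mul_cancel₀ hd, one_mul]
  have e1 : ext (L ^ (j + 1)) g ((L : ℤ) • y + toSite (r k) + (L : ℤ) • unitVec μ) = ext (L ^ j) g (y + unitVec μ) := by
    rw [show (L : ℤ) • y + toSite (r k) + (L : ℤ) • unitVec μ = (L : ℤ) • (y + unitVec μ) + toSite (r k) by rw [smul_add]; abel]
    exact ext_succ_apply hL (hr k) j g (y + unitVec μ)
  have e2 : ext (L ^ (j + 1)) g ((L : ℤ) • y + toSite (r k)) = ext (L ^ j) g y := ext_succ_apply hL (hr k) j g y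
  rw [e1, e2]
  simp only [dz, ext_apply, Pi.smul_apply, smul_eq_mul]
  ring

end SymLetters

/-! ## §3 The (0.4) instance: nilpotency of `compDefectSymAt` on block-constant pure gauges -/

section SymInstance

variable {L : ℕ} (hL : 0 < L) (r : ℕ → (Fin d → ℕ)) (hr : ∀ k, r k ∈ box d L)
include hL hr

/-- [folklore] **THE COMPOSITE (0.4) AVERAGE ON BLOCK-CONSTANT PURE GAUGES**: `compLinAvgSymAt ρs L k (dz (ext (L^(j+k)) g)) = dz (ext (L^j) (|box L|^k • g))` (in-block roots). -/
theorem compLinAvgSymAt_dz_ext (g : Form0 d ℝ) (k j : ℕ) :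
    compLinAvgSymAt (fun k => toSite (r k)) L k (dz (ext (L ^ (j + k)) g)) = dz (ext (L ^ j) ((((box d L).card : ℝ) ^ k) • g)) :=
  compAvOf_dz_ext (avSym (fun k => toSite (r k)) L) L ((box d L).card : ℝ) (fun k j g => avSym_dz_ext_succ hL r hr k j g) g k j

/-- [folklore] **NILPOTENCY OF THE COMPOSITE (0.4) DEFECT POTENTIAL**: `compDefectSymAt ρs L m (dz (ext (L^(j+m)) g)) = 0` for all `m`, `j` (in-block roots) — every level's
symmetrised block potential sees an exact form constant on its own blocks. -/
theorem compDefectSymAt_dz_ext (g : Form0 d ℝ) (m j : ℕ) :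
    compDefectSymAt (fun k => toSite (r k)) L m (dz (ext (L ^ (j + m)) g)) = 0 :=
  compDefectOf_dz_ext (avSym (fun k => toSite (r k)) L) (lamSym (fun k => toSite (r k)) L) L ((box d L).card : ℝ)
    (fun k j g => avSym_dz_ext_succ hL r hr k j g) (fun k j g => zetaS_dz_ext_succ hL (hr k) j g) g m j

/-- [folklore] The case `j = 0`: `compDefectSymAt ρs L m (dz (ext (L^m) g)) = 0` — the input of the corrector pair's mutual inversion at blocking `L^m`. -/
theorem compDefectSymAt_dz_ext_self (g : Form0 d ℝ) (m : ℕ) :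
    compDefectSymAt (fun k => toSite (r k)) L m (dz (ext (L ^ m) g)) = 0 :=
  compDefectOf_dz_ext_self (avSym (fun k => toSite (r k)) L) (lamSym (fun k => toSite (r k)) L) L ((box d L).card : ℝ)
    (fun k j g => avSym_dz_ext_succ hL r hr k j g) (fun k j g => zetaS_dz_ext_succ hL (hr k) j g) g m

end SymInstance

end

end Summit.QuantumFields.BalabanUV.Beta.CompositeAveragingCoarseExactGeneric
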